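import Mathlib
import Literature.Analysis.UnboundedOperators.ConjugateOperatorRegularity
import Literature.Analysis.UnboundedOperators.UnitaryRepSpectralMeasure
import Literature.Analysis.UnboundedOperators.FourierSpectrumCalculus
import Literature.Analysis.UnboundedOperators.StrongContRepresentationClosedProofs
import HarnessLib
import Summits.AtomisticToContinuum.FouriersLaw.Theorems.EmbeddedDrudeMourreMourreDissolutionLAPLocalisation
import Summits.AtomisticToContinuum.FouriersLaw.Theorems.EmbeddedDrudeMourreMourreDissolutionLAPResolventCalculus

/-!
# Stub `stub_mourreThresholdLAP` — Mourre LAP infrastructure 10: the functional calculus `g(H/2π)`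

Item `stmt-AtomisticToContinuum-12594` (crux `MourreDissolution` of route `EmbeddedDrudeMourre`,
sub-problem `FouriersLaw`), line `separable-vertex-faddeev-pair-sector`, stub S6
`stub_mourreThresholdLAP` (Mourre's limiting absorption principle; NOT in the tree). The remainder
of step L0 of the proof map — the algebra of the smooth functional calculus through the group,
`fourierCalculus U g = ∫ 𝓕g(a) U(a) da = g(H/2π)`, at the OPERATOR level:

* §1 smeared operators: `U[k₁] U[k₂] = U[k₁ ⋆ k₂]` and `U[k₁] U[k₂] = U[k₂] U[k₁]`;
* §2 `g₁(H/2π) g₂(H/2π) = (g₁g₂)(H/2π)` (headline `fourierCalculus_mul_eq`), commutativity,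
  commutation with the group and with the resolvents `R(z)`, the adjoint `g(H/2π)* = ḡ(H/2π)` and
  self-adjointness for real symbols;
* §3 `g(H/2π)` maps the whole space into `D(H)` with `H g(H/2π) = (energyMul g)(H/2π)`
  (`φ₁(H) = Hφ(H)`, `φ₁(x) = xφ(x)`; closed-graph argument from the tree's multiplier rule on `D(H)`);
* §4 `g(H/2π)ψ = ψ` when `g(·/2π) = 1` on a measurable set carrying the spectral measure `μ_ψ`
  (spectral support), from `μ_{-ψ + g(H/2π)ψ} = |-1 + g(·/2π)|² μ_ψ`.
-/

noncomputable section

open MeasureTheory Complex Filter Topology Set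
open scoped InnerProductSpace ComplexConjugate SchwartzMap FourierTransform ENNReal NNReal
  Convolution

namespace Summit.AtomisticToContinuum.FouriersLaw.Theorems.MourreDissolution

open Literature.Analysis.UnboundedOperators
open Literature.Analysis.UnboundedOperators.UnitaryRep

variable {H : Type*} [NormedAddCommGroup H] [InnerProductSpace ℂ H] [CompleteSpace H]

/-! ## §1. The algebra of smeared operators -/

/-- The convolution of two integrable kernels on `ℝ` is integrable. [folklore] -/
theorem integrable_convolution_kernel {k₁ k₂ : ℝ → ℂ} (hk₁ : Integrable k₁) (hk₂ : Integrable k₂) :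
    Integrable fun s : ℝ => ∫ t, k₁ t * k₂ (s - t) := by
  have h := hk₁.integrable_convolution (ContinuousLinearMap.mul ℂ ℂ) hk₂
  refine h.congr (ae_of_all _ fun s => ?_)
  simp only [convolution_def, ContinuousLinearMap.mul_apply']

/-- **`U[k₁] U[k₂] = U[k₁ ⋆ k₂]`** at the operator level (the tree's
`integral_smul_appReal_integral_smul_appReal`, bundled). [folklore] -/
theorem smear_mul_smear (U : OneParameterUnitaryGroup H) {k₁ k₂ : ℝ → ℂ} (hk₁ : Integrable k₁)
    (hk₂ : Integrable k₂) :
    U.smear k₁ * U.smear k₂ = U.smear fun s => ∫ t, k₁ t * k₂ (s - t) := by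
  refine ContinuousLinearMap.ext fun f => ?_
  rw [mul_apply_eq_comp, U.smear_apply hk₂, U.smear_apply hk₁,
    U.smear_apply (integrable_convolution_kernel hk₁ hk₂),
    U.integral_smul_appReal_integral_smul_appReal hk₁ hk₂]

/-- Convolution on `ℝ` is commutative (substitute `t ↦ s - t`). [folklore] -/
theorem convolution_kernel_comm (k₁ k₂ : ℝ → ℂ) (s : ℝ) :
    ∫ t, k₁ t * k₂ (s - t) = ∫ t, k₂ t * k₁ (s - t) := by
  rw [← integral_sub_left_eq_self (fun t => k₂ t * k₁ (s - t)) volume s]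
  refine integral_congr_ae (ae_of_all _ fun t => ?_)
  simp only [sub_sub_cancel, mul_comm]

/-- **Smeared operators commute**: `U[k₁] U[k₂] = U[k₂] U[k₁]`. [folklore] -/
theorem smear_comm (U : OneParameterUnitaryGroup H) {k₁ k₂ : ℝ → ℂ} (hk₁ : Integrable k₁)
    (hk₂ : Integrable k₂) : U.smear k₁ * U.smear k₂ = U.smear k₂ * U.smear k₁ := by
  rw [smear_mul_smear U hk₁ hk₂, smear_mul_smear U hk₂ hk₁]
  congr 1
  funext s
  exact convolution_kernel_comm k₁ k₂ s

/-- Smeared operators commute with the group: `U[k] U(t) = U(t) U[k]`. [folklore] -/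
theorem smear_appReal_comm (U : OneParameterUnitaryGroup H) {k : ℝ → ℂ} (hk : Integrable k)
    (t : ℝ) : U.smear k * U.appReal t = U.appReal t * U.smear k := by
  refine ContinuousLinearMap.ext fun f => ?_
  rw [mul_apply_eq_comp, mul_apply_eq_comp, U.smear_apply hk, U.smear_apply hk,
    U.appReal_apply_integral_smul_appReal' hk]

/-! ## §2. The algebra of `g(H/2π)` -/

/-- **Multiplicativity of the smooth functional calculus**:
`g₁(H/2π) g₂(H/2π) = (g₁ g₂)(H/2π)` (`U[𝓕g₁] U[𝓕g₂] = U[𝓕g₁ ⋆ 𝓕g₂] = U[𝓕(g₁g₂)]`).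
[folklore] -/
theorem fourierCalculus_mul (U : OneParameterUnitaryGroup H) (g₁ g₂ : 𝓢(ℝ, ℂ)) :
    U.fourierCalculus g₁ * U.fourierCalculus g₂ =
      U.fourierCalculus (SchwartzMap.smulLeftCLM ℂ (g₁ : ℝ → ℂ) g₂) := by
  rw [fourierCalculus, fourierCalculus, fourierCalculus,
    smear_mul_smear U (𝓕 g₁ : 𝓢(ℝ, ℂ)).integrable (𝓕 g₂ : 𝓢(ℝ, ℂ)).integrable]
  congr 1
  funext s
  exact integral_fourier_mul_fourier_sub g₁ g₂ s

/-- The pointwise product of Schwartz symbols is commutative. [folklore] -/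
theorem smulLeftCLM_comm (g₁ g₂ : 𝓢(ℝ, ℂ)) :
    SchwartzMap.smulLeftCLM ℂ (g₁ : ℝ → ℂ) g₂ = SchwartzMap.smulLeftCLM ℂ (g₂ : ℝ → ℂ) g₁ := by
  ext x
  rw [SchwartzMap.smulLeftCLM_apply_apply g₁.hasTemperateGrowth,
    SchwartzMap.smulLeftCLM_apply_apply g₂.hasTemperateGrowth, smul_eq_mul, smul_eq_mul, mul_comm]

/-- **Functions of `H` commute**: `g₁(H/2π) g₂(H/2π) = g₂(H/2π) g₁(H/2π)`. [folklore] -/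
theorem fourierCalculus_comm (U : OneParameterUnitaryGroup H) (g₁ g₂ : 𝓢(ℝ, ℂ)) :
    U.fourierCalculus g₁ * U.fourierCalculus g₂ = U.fourierCalculus g₂ * U.fourierCalculus g₁ := by
  rw [fourierCalculus_mul, fourierCalculus_mul, smulLeftCLM_comm]

/-- `g(H/2π)` commutes with the group. [folklore] -/
theorem fourierCalculus_appReal_comm (U : OneParameterUnitaryGroup H) (g : 𝓢(ℝ, ℂ)) (t : ℝ) :
    U.fourierCalculus g * U.appReal t = U.appReal t * U.fourierCalculus g :=
  smear_appReal_comm U (𝓕 g : 𝓢(ℝ, ℂ)).integrable t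

/-- `g(H/2π)` commutes with the resolvents `R(z)`, `Im z ≠ 0`. [folklore] -/
theorem fourierCalculus_resolventAt_comm (U : OneParameterUnitaryGroup H) (g : 𝓢(ℝ, ℂ)) {z : ℂ}
    (hz : z.im ≠ 0) :
    U.fourierCalculus g * resolventAt U z = resolventAt U z * U.fourierCalculus g :=
  smear_comm U (𝓕 g : 𝓢(ℝ, ℂ)).integrable (integrable_resolventKernelAt_of_ne hz)

/-- Resolvents commute with the group. [folklore] -/
theorem resolventAt_appReal_comm (U : OneParameterUnitaryGroup H) {z : ℂ} (hz : z.im ≠ 0)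
    (t : ℝ) : resolventAt U z * U.appReal t = U.appReal t * resolventAt U z :=
  smear_appReal_comm U (integrable_resolventKernelAt_of_ne hz) t

/-- **The adjoint of `g(H/2π)` is `ḡ(H/2π)`**: `⟪g(H/2π) f, f'⟫ = ⟪f, ḡ(H/2π) f'⟫`
(`U[k]* = U[k†]` and `(𝓕g)† = 𝓕ḡ`). [folklore] -/
theorem inner_fourierCalculus_left (U : OneParameterUnitaryGroup H) {g gc : 𝓢(ℝ, ℂ)}
    (hgc : ∀ x, gc x = conj (g x)) (f f' : H) :
    ⟪U.fourierCalculus g f, f'⟫_ℂ = ⟪f, U.fourierCalculus gc f'⟫_ℂ := by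
  rw [fourierCalculus_apply, fourierCalculus_apply,
    U.inner_integral_smul_appReal_left (𝓕 g : 𝓢(ℝ, ℂ)).integrable]
  congr 1
  refine integral_congr_ae (ae_of_all _ fun a => ?_)
  simp only
  rw [fourier_schwartz_conj hgc a]

/-- **`g(H/2π)* = ḡ(H/2π)`** as bounded operators. [folklore] -/
theorem adjoint_fourierCalculus (U : OneParameterUnitaryGroup H) {g gc : 𝓢(ℝ, ℂ)}
    (hgc : ∀ x, gc x = conj (g x)) :
    ContinuousLinearMap.adjoint (U.fourierCalculus g) = U.fourierCalculus gc := by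
  refine ContinuousLinearMap.ext fun f' => ext_inner_left ℂ fun f => ?_
  rw [ContinuousLinearMap.adjoint_inner_right]
  exact inner_fourierCalculus_left U hgc f f'

/-- **`g(H/2π)` is self-adjoint for a real symbol `g`.** [folklore] -/
theorem isSelfAdjoint_fourierCalculus (U : OneParameterUnitaryGroup H) {g : 𝓢(ℝ, ℂ)}
    (hg : ∀ ξ, conj (g ξ) = g ξ) : IsSelfAdjoint (U.fourierCalculus g) := by
  rw [ContinuousLinearMap.isSelfAdjoint_iff']
  exact adjoint_fourierCalculus U fun x => (hg x).symm

/-- For a real symbol, `⟪g(H/2π) f, f'⟫ = ⟪f, g(H/2π) f'⟫`. [folklore] -/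
theorem inner_fourierCalculus_left_of_real (U : OneParameterUnitaryGroup H) {g : 𝓢(ℝ, ℂ)}
    (hg : ∀ ξ, conj (g ξ) = g ξ) (f f' : H) :
    ⟪U.fourierCalculus g f, f'⟫_ℂ = ⟪f, U.fourierCalculus g f'⟫_ℂ :=
  inner_fourierCalculus_left U (fun x => (hg x).symm) f f'

/-- `energyMul g` is real when `g` is. [folklore] -/
theorem conj_energyMul_apply {g : 𝓢(ℝ, ℂ)} (hg : ∀ ξ, conj (g ξ) = g ξ) (ξ : ℝ) :
    conj (energyMul g ξ) = energyMul g ξ := by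
  rw [energyMul_apply, map_mul, Complex.conj_ofReal, hg]

/-- Admissible cutoffs are real: `g(H/2π)` and `(energyMul g)(H/2π)` are self-adjoint for
`IsRealCutoffOn J g`. [folklore] -/
theorem IsRealCutoffOn.isSelfAdjoint {U : OneParameterUnitaryGroup H} {J : Set ℝ} {g : 𝓢(ℝ, ℂ)}
    (hg : IsRealCutoffOn J g) :
    IsSelfAdjoint (U.fourierCalculus g) ∧ IsSelfAdjoint (U.fourierCalculus (energyMul g)) :=
  ⟨isSelfAdjoint_fourierCalculus U hg.1, isSelfAdjoint_fourierCalculus U (conj_energyMul_apply hg.1)⟩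

/-! ## §3. `g(H/2π)` maps into `D(H)` with `H g(H/2π) = (energyMul g)(H/2π)` -/

/-- **Closed-graph transfer**: if bounded operators `S, T` satisfy `S x ∈ D(iH)` and
`iH (S x) = T x` for all `x` in the (dense) domain of the (closed) generator, then the same holds
for every vector. [folklore] -/
theorem mem_generator_domain_of_forall_mem (U : OneParameterUnitaryGroup H) {S T : H →L[ℂ] H}
    (h : ∀ x : (OneParameterGroup.generator U.toStrongContRepresentation).domain,
      ∃ hx : S x ∈ (OneParameterGroup.generator U.toStrongContRepresentation).domain,
        OneParameterGroup.generator U.toStrongContRepresentation ⟨_, hx⟩ = T x) (f : H) :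
    ∃ hf : S f ∈ (OneParameterGroup.generator U.toStrongContRepresentation).domain,
      OneParameterGroup.generator U.toStrongContRepresentation ⟨_, hf⟩ = T f := by
  set gen := OneParameterGroup.generator U.toStrongContRepresentation with hgen
  have hclosed : IsClosed (gen.graph : Set (H × H)) :=
    C0Semigroup.isClosed_generator_holds (OneParameterGroup.toC0Semigroup U.toStrongContRepresentation)
  have hdense : Dense (gen.domain : Set H) :=
    OneParameterGroup.dense_generator_domain U.toStrongContRepresentation
  set Φ : H → H × H := fun g => (S g, T g) with hΦ
  have hΦc : Continuous Φ := by
    simp only [hΦ]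
    fun_prop
  have hmem : ∀ g ∈ (gen.domain : Set H), Φ g ∈ (gen.graph : Set (H × H)) := by
    intro g hg
    obtain ⟨hx, hval⟩ := h ⟨g, hg⟩
    rw [SetLike.mem_coe, LinearPMap.mem_graph_iff]
    exact ⟨⟨_, hx⟩, rfl, hval⟩
  have hlim : Φ f ∈ (gen.graph : Set (H × H)) := by
    haveI : (𝓝[(gen.domain : Set H)] f).NeBot := mem_closure_iff_nhdsWithin_neBot.1 (hdense f)
    have ht : Tendsto Φ (𝓝[(gen.domain : Set H)] f) (𝓝 (Φ f)) :=
      (hΦc.tendsto f).mono_left nhdsWithin_le_nhds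
    exact hclosed.mem_of_tendsto ht (eventually_mem_nhdsWithin.mono hmem)
  rw [SetLike.mem_coe, LinearPMap.mem_graph_iff] at hlim
  obtain ⟨y, hy1, hy2⟩ := hlim
  have hy : (y : H) = S f := hy1
  refine ⟨hy ▸ y.2, ?_⟩
  have : (⟨S f, hy ▸ y.2⟩ : gen.domain) = y := Subtype.ext hy.symm
  rw [this, hy2]

/-- The tree's multiplier symbol `2πξ • h` is `energyMul h`. [folklore] -/
theorem smulLeftCLM_two_pi_eq_energyMul (h : 𝓢(ℝ, ℂ)) :
    SchwartzMap.smulLeftCLM ℂ (fun ξ : ℝ => 2 * Real.pi * ξ) h = energyMul h := by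
  have htemp : (fun ξ : ℝ => 2 * Real.pi * ξ).HasTemperateGrowth := by fun_prop
  ext ξ
  rw [SchwartzMap.smulLeftCLM_apply_apply htemp, energyMul_apply, Complex.real_smul]

/-- **`g(H/2π)` maps the whole space into `D(H)`, and `H g(H/2π) f = (energyMul g)(H/2π) f`**
(`φ₁(H) = H φ(H)` for `φ₁(x) = x φ(x)`; the multiplier rule of the tree on `D(H)` plus the
closed-graph transfer). [folklore] -/
theorem fourierCalculus_mem_hamiltonian_domain (U : OneParameterUnitaryGroup H) (g : 𝓢(ℝ, ℂ))
    (f : H) :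
    ∃ hf : U.fourierCalculus g f ∈ U.hamiltonian.domain,
      U.hamiltonian ⟨_, hf⟩ = U.fourierCalculus (energyMul g) f := by
  have key := mem_generator_domain_of_forall_mem U (S := U.fourierCalculus g)
    (T := I • U.fourierCalculus (energyMul g)) (fun x => ?_) f
  · obtain ⟨hf, hval⟩ := key
    refine ⟨hf, ?_⟩
    rw [hamiltonian_apply]
    change (-I) • OneParameterGroup.generator U.toStrongContRepresentation ⟨_, hf⟩ = _
    rw [hval, FunLike.coe_smul, Pi.smul_apply, smul_smul]
    simp
  · obtain ⟨hy, hHy⟩ := U.hamiltonian_integral_fourier_smul_appReal g x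
    have e : U.fourierCalculus g x = ∫ a, (𝓕 g : 𝓢(ℝ, ℂ)) a • U.appReal a (x : H) :=
      fourierCalculus_apply U g x
    refine ⟨by rw [e]; exact hy, ?_⟩
    have hgen : OneParameterGroup.generator U.toStrongContRepresentation ⟨_, hy⟩ =
        I • U.hamiltonian ⟨_, hy⟩ := by
      rw [hamiltonian_apply, smul_smul]
      simp
    have : (⟨U.fourierCalculus g x, by rw [e]; exact hy⟩ :
        (OneParameterGroup.generator U.toStrongContRepresentation).domain) = ⟨_, hy⟩ :=
      Subtype.ext e
    rw [this, hgen, hHy, FunLike.coe_smul, Pi.smul_apply, fourierCalculus_apply,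
      smulLeftCLM_two_pi_eq_energyMul]

/-- `g(H/2π) f ∈ D(H)`. [folklore] -/
theorem fourierCalculus_apply_mem_hamiltonian_domain (U : OneParameterUnitaryGroup H)
    (g : 𝓢(ℝ, ℂ)) (f : H) : U.fourierCalculus g f ∈ U.hamiltonian.domain :=
  (fourierCalculus_mem_hamiltonian_domain U g f).1

/-- **`(H - z) φ(H) f = φ₁(H) f - z φ(H) f`, hence `R(z) (φ₁(H) f - z φ(H) f) = φ(H) f`.**
[folklore] -/
theorem resolventAt_fourierCalculus_energyMul_sub (U : OneParameterUnitaryGroup H) (g : 𝓢(ℝ, ℂ))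
    {z : ℂ} (hz : z.im ≠ 0) (f : H) :
    resolventAt U z (U.fourierCalculus (energyMul g) f - z • U.fourierCalculus g f) =
      U.fourierCalculus g f := by
  obtain ⟨hf, hval⟩ := fourierCalculus_mem_hamiltonian_domain U g f
  have := resolventAt_hamiltonian_sub_of_ne hz U ⟨_, hf⟩
  rwa [hval] at this

/-! ## §4. Spectral support: `g(H/2π)ψ = ψ` when the symbol is `1` on the support of `μ_ψ` -/

/-- **`g(H/2π) ψ = ψ` when `g(·/2π) = 1` on a measurable set of full `μ_ψ`-measure**
(`w = -ψ + g(H/2π)ψ` has spectral measure `|-1 + g(·/2π)|² μ_ψ = 0`, so `‖w‖² = μ_w(ℝ) = 0`).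
[folklore] -/
theorem fourierCalculus_apply_eq_self_of_specMeasure (U : OneParameterUnitaryGroup H)
    (g : 𝓢(ℝ, ℂ)) (ψ : H) {S : Set ℝ} (hS : MeasurableSet S) (hsupp : specMeasure U ψ Sᶜ = 0)
    (h1 : ∀ ξ ∈ S, g (ξ / (2 * Real.pi)) = 1) : U.fourierCalculus g ψ = ψ := by
  set w := (-1 : ℂ) • ψ + U.fourierCalculus g ψ with hw
  have hS0 : specMeasure U w S = 0 :=
    specMeasure_smul_add_fourierCalculus_null U ψ (-1) g hS fun ξ hξ => by rw [h1 ξ hξ]; ring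
  have hSc0 : specMeasure U w Sᶜ = 0 := by
    rw [hw, specMeasure_smul_add_fourierCalculus, withDensity_apply _ hS.compl,
      Measure.restrict_eq_zero.2 hsupp, lintegral_zero_measure]
  have huniv : specMeasure U w univ = 0 := by
    rw [← Set.union_compl_self S, measure_union disjoint_compl_right hS.compl, hS0, hSc0, add_zero]
  have hnorm : ‖w‖ ^ 2 = 0 := by
    rw [← specMeasure_real_univ U w, Measure.real, huniv, ENNReal.toReal_zero]
  have hw0 : w = 0 := by
    rw [← norm_eq_zero]
    exact pow_eq_zero_iff two_ne_zero |>.1 hnorm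
  rw [hw, neg_one_smul, neg_add_eq_zero] at hw0
  exact hw0.symm

/-! ## §5. Headline (registered helper stub) -/

/-- **Multiplicativity of the smooth functional calculus through the group, headline form** (all
binders explicit; registered helper stub of `stub_mourreThresholdLAP`):
`g₁(H/2π) g₂(H/2π) = (g₁g₂)(H/2π)` for Schwartz symbols. [folklore] -/
theorem fourierCalculus_mul_eq :
    ∀ (K : Type) [NormedAddCommGroup K] [InnerProductSpace ℂ K] [CompleteSpace K]
      (U : Literature.Analysis.UnboundedOperators.OneParameterUnitaryGroup K)
      (g₁ g₂ : SchwartzMap ℝ ℂ),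
      U.fourierCalculus g₁ * U.fourierCalculus g₂ =
        U.fourierCalculus (SchwartzMap.smulLeftCLM ℂ (g₁ : ℝ → ℂ) g₂) := by
  intro K _ _ _ U g₁ g₂
  exact fourierCalculus_mul U g₁ g₂

end Summit.AtomisticToContinuum.FouriersLaw.Theorems.MourreDissolution
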